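import Summits.ResolutionOfSingularities.ResolutionOfSingularities.Theorems.PurelyInseparableDim4ResConeResidualTransform
import HarnessLib
import HarnessLib.Audit.Tags

/-!
# Purely inseparable four-folds — a power cone has a degree-`d` witness monomial off `x_a`
# (cell `res-dim4-pi`, K2(p) lane, slice B brick K10)

[OURS · counted 0 · cell `res-dim4-pi` · K2(p) lane holder res-dim4-p-12 g3's bricks by signature (bus
2026-08-28 23:28Z, SLICE-B-ARCH v1.1), brick K10, seat res-dim4-p-9 g3.]  Nothing here proves K2(p),
`NoIsolatedTrap p p` or resolution of singularities in dimension ≥ 4 / characteristic `p`.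

Two small inputs of the holder's K8 «generic ledger ⇒ Hasse ledger» (membership form, hypotheses `hordG`,
`hμa`/`hμd`/`hμ`):

* `forall_le_degree_divMonomial` — the residual `G = F / x^r` of a state with `ord₀ F = o` has all its
  monomials in degree `≥ o − |r|`.
* `coeff_single_pow_linearForm` — the `x_c^d`-coefficient of `(Σ ℓᵢ xᵢ)^d` is `ℓ_c^d` (EVERY characteristic:
  multinomial coefficient `1`), via the projection killing the letters `≠ c`; hence
  **`exists_coeff_ne_zero_of_powerCone`**: a power cone `resForm s = a₀·(Σ ℓᵢ xᵢ)^d`, `a₀ ≠ 0`, living on a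
  letter `c ≠ a` (`ℓ_c ≠ 0`) has the degree-`d` monomial `x_c^d` off `x_a` with non-zero coefficient `a₀ ℓ_c^d`.

bears_on: LADDER-RESOLUTION:D157-DOOR2 (res-dim4-pi · K2(p) · slice B · K10).  Supports
stmt-ResolutionOfSingularities-16155 (helper).
-/

set_option linter.dupNamespace false -- mandated namespace of this single-conjunct summit

noncomputable section

namespace Summit.ResolutionOfSingularities.ResolutionOfSingularities.Theorems.PIDim4

namespace ResCone

open MvPolynomial Finset
open Literature.AlgebraicGeometry.Resolution
open Literature.AlgebraicGeometry.Resolution.CentreBlowup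
open Literature.AlgebraicGeometry.Resolution.Hauser2010
open Literature.AlgebraicGeometry.Resolution.HauserPerlega2019

variable {K : Type} [Field K]

/-! ## 1. Degrees of the residual -/

/-- **The residual lives in degree `≥ o − |r|`**: if `ord₀ F = o` then every monomial of `F / x^r` has degree
`≥ o − |r|`. [folklore] -/
theorem forall_le_degree_divMonomial {s : State K} {o : ℕ} (ho : ordZero s.F = o) :
    ∀ e ∈ (s.F.divMonomial s.r).support, o - s.r.degree ≤ e.degree := by
  intro e he
  rw [MvPolynomial.mem_support_iff, coeff_divMonomial] at he
  have h := forall_le_degree_of_ordZero_eq ho (s.r + e) (MvPolynomial.mem_support_iff.mpr he)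
  rw [map_add] at h
  omega

/-! ## 2. The `x_c^d`-coefficient of a power of a linear form -/

/-- The projection killing every letter but `x_c` does not change the pure `x_c`-coefficients. [folklore] -/
theorem coeff_single_aeval_keep (c : Fin 4) (k : ℕ) (P : MvPolynomial (Fin 4) K) :
    coeff (Finsupp.single c k) (aeval (fun i => if i = c then (X c : MvPolynomial (Fin 4) K) else 0) P) =
      coeff (Finsupp.single c k) P := by
  classical
  refine MvPolynomial.induction_on' P (fun e a => ?_) (fun A B hA hB => ?_)
  · rw [aeval_monomial, algebraMap_eq, coeff_monomial]
    by_cases he : ∀ i, i ≠ c → e i = 0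
    · -- `e = single c n`: the monomial is kept
      obtain ⟨n, rfl⟩ : ∃ n, e = Finsupp.single c n := ⟨e c, by
        ext i
        by_cases hic : i = c
        · subst hic; rw [Finsupp.single_eq_same]
        · rw [Finsupp.single_eq_of_ne hic, he i hic]⟩
      have hprod : ((Finsupp.single c n).prod fun i k =>
          (if i = c then (X c : MvPolynomial (Fin 4) K) else 0) ^ k) = X c ^ n := by
        rw [Finsupp.prod_single_index, if_pos rfl]
        exact pow_zero _
      rw [hprod, X_pow_eq_monomial, C_mul_monomial, mul_one, coeff_monomial]
    · push Not at he
      obtain ⟨i, hic, hi⟩ := he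
      have hprod : (e.prod fun i k => (if i = c then (X c : MvPolynomial (Fin 4) K) else 0) ^ k) = 0 := by
        refine Finset.prod_eq_zero (i := i) (Finsupp.mem_support_iff.mpr hi) ?_
        show (if i = c then (X c : MvPolynomial (Fin 4) K) else 0) ^ e i = 0
        rw [if_neg hic, zero_pow hi]
      rw [hprod, mul_zero, coeff_zero, if_neg]
      intro h
      rw [h, Finsupp.single_eq_of_ne hic] at hi
      exact hi rfl
  · rw [map_add, coeff_add, coeff_add, hA, hB]

/-- **`coeff (x_c^d) (Σᵢ ℓᵢ xᵢ)^d = ℓ_c^d`** in every characteristic (project onto the `x_c`-line).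
[folklore] -/
theorem coeff_single_pow_linearForm (ℓ : Fin 4 → K) (c : Fin 4) (d : ℕ) :
    coeff (Finsupp.single c d) ((∑ i, C (ℓ i) * X i : MvPolynomial (Fin 4) K) ^ d) = ℓ c ^ d := by
  rw [← coeff_single_aeval_keep c d, map_pow, map_sum]
  have hsum : ∑ i, aeval (fun i => if i = c then (X c : MvPolynomial (Fin 4) K) else 0) (C (ℓ i) * X i) =
      C (ℓ c) * X c := by
    rw [Finset.sum_eq_single c]
    · rw [map_mul, algHom_C, algebraMap_eq, aeval_X, if_pos rfl]
    · intro i _ hic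
      rw [map_mul, aeval_X, if_neg hic, mul_zero]
    · exact fun h => absurd (Finset.mem_univ c) h
  rw [hsum, mul_pow, ← C_pow, X_pow_eq_monomial, C_mul_monomial, mul_one, coeff_monomial, if_pos rfl]

/-- A power of a linear form living on the letter `c` has the monomial `x_c^d`, which is off `x_a` for `c ≠ a`.
[folklore] -/
theorem exists_coeff_ne_zero_of_eq_C_mul_pow {G : MvPolynomial (Fin 4) K} {a₀ : K} {ℓ : Fin 4 → K} {d : ℕ}
    (hG : G = C a₀ * (∑ i, C (ℓ i) * X i) ^ d) (ha₀ : a₀ ≠ 0) {a c : Fin 4} (hca : c ≠ a) (hc : ℓ c ≠ 0) :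
    ∃ μ : Fin 4 →₀ ℕ, μ a = 0 ∧ μ.degree = d ∧ coeff μ G ≠ 0 := by
  refine ⟨Finsupp.single c d, Finsupp.single_eq_of_ne (Ne.symm hca), Finsupp.degree_single c d, ?_⟩
  rw [hG, coeff_C_mul, coeff_single_pow_linearForm]
  exact mul_ne_zero ha₀ (pow_ne_zero _ hc)

/-- **K10: a power cone living on a letter `c ≠ a` has a degree-`d` witness monomial off `x_a`**
(`resForm s = a₀·(Σ ℓᵢ xᵢ)^d`, `a₀ ≠ 0`, `ℓ_c ≠ 0` ⇒ `coeff (x_c^d) (resForm s) = a₀ ℓ_c^d ≠ 0`; every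
characteristic). [folklore] -/
theorem exists_coeff_ne_zero_of_powerCone {s : State K} {a₀ : K} {ℓ : Fin 4 → K} {d : ℕ}
    (hg : resForm s = C a₀ * (∑ i, C (ℓ i) * X i) ^ d) (ha₀ : a₀ ≠ 0) {a c : Fin 4} (hca : c ≠ a)
    (hc : ℓ c ≠ 0) : ∃ μ : Fin 4 →₀ ℕ, μ a = 0 ∧ μ.degree = d ∧ coeff μ (resForm s) ≠ 0 :=
  exists_coeff_ne_zero_of_eq_C_mul_pow hg ha₀ hca hc

end ResCone

end Summit.ResolutionOfSingularities.ResolutionOfSingularities.Theorems.PIDim4
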